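import Mathlib
import HarnessLib
import Literature.MathematicalPhysics.QuantumLattice.GrassmannLinearSubstitution
import Summits.HubbardSuperconductivity.HubbardSuperconductivity.Theorems.KLProgrammeKLRegimeWickTwoCopySubstitution
import Summits.HubbardSuperconductivity.HubbardSuperconductivity.Theorems.KLProgrammeKLRegimeWickTwoCopyKernel

/-!
# Route `KLProgramme` — ENGINE child gen 6 (stmt-HubbardSuperconductivity-20236 `KLRegimeEngineV16`), `stub_engine_step_values` (E2-v10):
# the PUSH-FORWARD of a `k`-line two-vertex term from the sector fields to the physical fields — the last generic link between the value form
# on sector preimages (…WickCrossContractionValue / …GramValue) and the pair-label values of `klw_wickPairAmplitude_succ_lines`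
# (cell gate-hubbard-kl, seat p5 g5)

p5 g4's `dblFold_crossContract_map` (p512067) writes the physical `k`-line term of two push-forwards `map M a′`, `map M b′` as the push-forward of the
sector-field term with the pulled-back lines `MᵀC_iM`; the value forms bound the sector-field kernels at every labelled tuple and every colouring.  Here:

* **`norm_kernel_map_le_of_rowSum`** — a kernel of a push-forward `map f F` at a fixed physical tuple is at most `R^m · B` if the ROW sums of
  `‖matrix of f‖` are `≤ R` and the kernels of `F` are `≤ B` uniformly (the `L^∞` twin of `EngineV8.norm_kernel_map_le'`, which uses the entry bound
  and the `ℓ¹` norm of `F`);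
* **`norm_kernel_map_dblFold_le_of_rowSum`** — through the fold: `≤ R^m · Σ_s B_s` from colouring-wise bounds `B_s`;
* **`norm_kernel_dblFold_crossContract_map_le`** — the physical `k`-line term `dblFold((Δ_×(C_{k−1})∘⋯∘Δ_×(C_0))((map M a′)⁰(map M b′)¹))` at any
  physical tuple is `≤ R^m · Σ_s B_s`, `B_s` bounding the sector-field term with lines `MᵀC_iM` at colouring `s` (uniformly in the labelled tuple);
* `sum_norm_sectorSubMatrix_eq`, **`sum_norm_sectorSubMatrix_le`** — the row sums of the sector-field substitution `S(F)` of BGM (2.48):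
  `Σ_Y ‖S(F) K Y‖ = ((βL²)⁻¹·#SpaceTimeIdx) · Σ_ω ‖F_ω(k_K)‖ = ε_x⁻¹ · Σ_ω ‖F_ω(k_K)‖` (`ε_x = β/(2M)` the time weight, `imagTimeWeight_mul_card`).

Generic / model bookkeeping; no definitions, no named facts, nothing about sizes is asserted.
-/

noncomputable section

namespace Summit.HubbardSuperconductivity.HubbardSuperconductivity.Theorems.KLRegimeWick

set_option linter.dupNamespace false -- summit = problem name (single-conjunct summit), D-0017

open Literature.MathematicalPhysics.QuantumLattice Literature.Probability.LatticeModels GrassmannAlgebra Finset Matrix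

/-! ## §1 Kernels of a push-forward: row sums × sup -/

section Pushforward

variable {Γ Γ' : Type*} [Fintype Γ] [DecidableEq Γ] [Fintype Γ'] [DecidableEq Γ']

omit [Fintype Γ'] [DecidableEq Γ'] in
/-- **Kernels of a push-forward, `L^∞` form**: if every row sum of the substitution matrix is `≤ R` (`Σ_b ‖M a b‖ ≤ R`) and every kernel of `F` in
degree `m` is `≤ B` (`B ≥ 0`), then `‖kernel (map f F) m X′‖ ≤ R^m · B`. [folklore] -/
theorem norm_kernel_map_le_of_rowSum (f : (Γ → ℂ) →ₗ[ℂ] (Γ' → ℂ)) (F : GrassmannAlgebra ℂ Γ) (m : ℕ) (X' : Fin m → Γ') {R B : ℝ}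
    (hrow : ∀ a, ∑ b, ‖LinearMap.toMatrix' f a b‖ ≤ R) (hB0 : 0 ≤ B) (hB : ∀ X : Fin m → Γ, ‖kernel ℂ F m X‖ ≤ B) :
    ‖kernel ℂ (ExteriorAlgebra.map f F) m X'‖ ≤ R ^ m * B := by
  rw [kernel_map]
  refine (norm_sum_le _ _).trans ?_
  calc ∑ X : Fin m → Γ, ‖(∏ i, LinearMap.toMatrix' f (X' i) (X i)) * kernel ℂ F m X‖
      ≤ ∑ X : Fin m → Γ, (∏ i, ‖LinearMap.toMatrix' f (X' i) (X i)‖) * B := sum_le_sum fun X _ => by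
        rw [norm_mul, norm_prod]
        exact mul_le_mul_of_nonneg_left (hB X) (prod_nonneg fun i _ => norm_nonneg _)
    _ = (∏ i : Fin m, ∑ b : Γ, ‖LinearMap.toMatrix' f (X' i) b‖) * B := by rw [← sum_mul, Finset.prod_univ_sum, Fintype.piFinset_univ]
    _ ≤ R ^ m * B := by
        refine mul_le_mul_of_nonneg_right ?_ hB0
        calc ∏ i : Fin m, ∑ b : Γ, ‖LinearMap.toMatrix' f (X' i) b‖ ≤ ∏ _i : Fin m, R :=
              prod_le_prod (fun i _ => sum_nonneg fun b _ => norm_nonneg _) fun i _ => hrow _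
          _ = R ^ m := by rw [prod_const, card_univ, Fintype.card_fin]

omit [Fintype Γ'] [DecidableEq Γ'] in
/-- **Through the fold**: colouring-wise bounds `‖kernel T m (X, s)‖ ≤ B_s` for a two-copy element `T` give
`‖kernel (map f (dblFold T)) m X′‖ ≤ R^m · Σ_s B_s`. [folklore] -/
theorem norm_kernel_map_dblFold_le_of_rowSum (f : (Γ → ℂ) →ₗ[ℂ] (Γ' → ℂ)) (T : GrassmannAlgebra ℂ (Γ × Fin 2)) (m : ℕ)
    (X' : Fin m → Γ') {R : ℝ} (hrow : ∀ a, ∑ b, ‖LinearMap.toMatrix' f a b‖ ≤ R) (B : (Fin m → Fin 2) → ℝ) (hB0 : ∀ s, 0 ≤ B s)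
    (hB : ∀ (s : Fin m → Fin 2) (X : Fin m → Γ), ‖kernel ℂ T m (fun i => (X i, s i))‖ ≤ B s) :
    ‖kernel ℂ (ExteriorAlgebra.map f (dblFold ℂ T)) m X'‖ ≤ R ^ m * ∑ s : Fin m → Fin 2, B s :=
  norm_kernel_map_le_of_rowSum f (dblFold ℂ T) m X' hrow (sum_nonneg fun s _ => hB0 s)
    fun X => (norm_kernel_dblFold_le T m X).trans (sum_le_sum fun s _ => hB s X)

/-- **The physical `k`-line two-vertex term of two push-forwards, at any physical tuple**: with lines `C_0, …, C_{k−1}` on the physical labels,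
`‖kernel (dblFold ((Δ_×(C_{k−1})∘⋯∘Δ_×(C_0))((map M a′)⁰·(map M b′)¹))) m X′‖ ≤ R^m · Σ_s B_s`, where `B_s` bounds the kernels at colouring `s` of the
SECTOR-FIELD term `(Δ_×(MᵀC_{k−1}M)∘⋯∘Δ_×(MᵀC_0M))(a′⁰·b′¹)` (`dblFold_crossContract_map`, p512067) and `R` the row sums of `‖M‖`. [folklore] -/
theorem norm_kernel_dblFold_crossContract_map_le {k m : ℕ} (M : Matrix Γ' Γ ℂ) (C : Fin k → Matrix Γ' Γ' ℂ)
    (a' b' : GrassmannAlgebra ℂ Γ) (X' : Fin m → Γ') {R : ℝ} (hrow : ∀ a, ∑ b, ‖M a b‖ ≤ R) (B : (Fin m → Fin 2) → ℝ)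
    (hB0 : ∀ s, 0 ≤ B s)
    (hB : ∀ (s : Fin m → Fin 2) (X : Fin m → Γ), ‖kernel ℂ (((List.ofFn fun i =>
      grassmannLaplacian ℂ (crossCov ℂ (M.transpose * C i * M))).reverse).prod (dblCopy ℂ 0 a' * dblCopy ℂ 1 b')) m
        (fun i => (X i, s i))‖ ≤ B s) :
    ‖kernel ℂ (dblFold ℂ (((List.ofFn fun i => grassmannLaplacian ℂ (crossCov ℂ (C i))).reverse).prod
        (dblCopy ℂ 0 (ExteriorAlgebra.map (Matrix.toLin' M) a') * dblCopy ℂ 1 (ExteriorAlgebra.map (Matrix.toLin' M) b')))) m X'‖ ≤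
      R ^ m * ∑ s : Fin m → Fin 2, B s := by
  rw [dblFold_crossContract_map]
  exact norm_kernel_map_dblFold_le_of_rowSum _ _ m X' (fun a => by simpa only [LinearMap.toMatrix'_toLin'] using hrow a) B hB0 hB

end Pushforward

/-! ## §2 The row sums of the sector-field substitution -/

section SectorSub

variable {L M N : ℕ} [NeZero L]

/-- **Row sums of `S(F)`**: `Σ_Y ‖S(F) K Y‖ = ((βL²)⁻¹ · #SpaceTimeIdx) · Σ_ω ‖F_ω(k_K)‖` (plane waves are unimodular; the spin and the charge of
the sector field are those of `K`). [cite: BenfattoGiulianiMastropietro2006, §2.5 (2.48)] -/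
theorem sum_norm_sectorSubMatrix_eq (β : ℝ) (F : Fin N → FreqMomentum L M → ℂ) (K : HubbardFieldIdx L M) :
    ∑ Y : SpaceTimeIdx L M × SectorLeg N, ‖sectorSubMatrix L M β F K Y‖ =
      (‖((1 / (β * (L : ℝ) ^ 2) : ℝ) : ℂ)‖ * Fintype.card (SpaceTimeIdx L M)) * ∑ ω : Fin N, ‖F ω K.1.1‖ := by
  classical
  rw [Fintype.sum_prod_type]
  have hx : ∀ x : SpaceTimeIdx L M, ∑ Y2 : SectorLeg N, ‖sectorSubMatrix L M β F K (x, Y2)‖ =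
      ‖((1 / (β * (L : ℝ) ^ 2) : ℝ) : ℂ)‖ * ∑ ω : Fin N, ‖F ω K.1.1‖ := by
    intro x
    rw [Fintype.sum_prod_type, Fintype.sum_prod_type, mul_sum]
    refine sum_congr rfl fun ω _ => ?_
    rw [Fintype.sum_eq_single K.1.2 fun σ hσ => ?_, Fintype.sum_eq_single K.2 fun c hc => ?_]
    · rw [sectorSubMatrix_apply, if_pos ⟨rfl, rfl⟩, norm_mul, norm_mul, Complex.norm_conj, norm_hubbardPlaneWave, mul_one]
    · rw [sectorSubMatrix_apply, if_neg (fun h => hc h.2.symm), norm_zero]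
    · exact sum_eq_zero fun c _ => by rw [sectorSubMatrix_apply, if_neg (fun h => hσ h.1.symm), norm_zero]
  simp_rw [hx]
  rw [sum_const, card_univ, nsmul_eq_mul]
  ring

/-- **Row sums of `S(F)` bounded**: if `‖F_ω(k)‖ ≤ 1` and at most `ρ₁` multipliers meet any momentum, then
`Σ_Y ‖S(F) K Y‖ ≤ ((βL²)⁻¹ · #SpaceTimeIdx) · ρ₁` (`= ρ₁/ε_x` with `ε_x·#SpaceTimeIdx = βL²`, `imagTimeWeight_mul_card`).
[cite: BenfattoGiulianiMastropietro2006, §2.5 (2.48)] -/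
theorem sum_norm_sectorSubMatrix_le (β : ℝ) (F : Fin N → FreqMomentum L M → ℂ) (hF : ∀ ω k, ‖F ω k‖ ≤ 1) {ρ₁ : ℕ}
    (hρ₁ : ∀ k : FreqMomentum L M, ((univ : Finset (Fin N)).filter fun ω => F ω k ≠ 0).card ≤ ρ₁) (K : HubbardFieldIdx L M) :
    ∑ Y : SpaceTimeIdx L M × SectorLeg N, ‖sectorSubMatrix L M β F K Y‖ ≤
      (‖((1 / (β * (L : ℝ) ^ 2) : ℝ) : ℂ)‖ * Fintype.card (SpaceTimeIdx L M)) * ρ₁ := by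
  classical
  rw [sum_norm_sectorSubMatrix_eq]
  refine mul_le_mul_of_nonneg_left ?_ (by positivity)
  calc ∑ ω : Fin N, ‖F ω K.1.1‖ = ∑ ω ∈ univ.filter (fun ω => F ω K.1.1 ≠ 0), ‖F ω K.1.1‖ := by
        rw [sum_filter]
        refine sum_congr rfl fun ω _ => ?_
        by_cases h : F ω K.1.1 = 0
        · rw [if_neg (not_not.2 h), h, norm_zero]
        · rw [if_pos h]
    _ ≤ ∑ _ω ∈ univ.filter (fun ω => F ω K.1.1 ≠ 0), (1 : ℝ) := sum_le_sum fun ω _ => hF ω _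
    _ ≤ ρ₁ := by
        rw [sum_const, nsmul_eq_mul, mul_one]
        exact_mod_cast hρ₁ K.1.1

end SectorSub

end Summit.HubbardSuperconductivity.HubbardSuperconductivity.Theorems.KLRegimeWick

end
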